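import Summits.Ventures.Crystal3D.Theorems.StickyWulffConstantGenericWallFloorGeneralRungTubes
import Summits.Ventures.Crystal3D.Theorems.StickyWulffConstantGenericWallFloorCubicCoords
import HarnessLib

/-!
# A checkable non-chain criterion: irrational pairs, and the general-filling rung for them

HONEST FRAMING. Venture `Summits/Ventures/Crystal3D` (cell `crystal3d-full`), helper for the crux
`GenericWallFloor` (stmt-Ventures-19480) of `route-Ventures-StickyWulffConstant`, REGISTERED line `WallLedgerG`,
open stub `stub_twoSlabAdhesion` (general fillings; ARCH v4).  Rung credit only; F-C1 not moved.

The rung `general_twoSlabAdhesion_nonChain` asks for a mirror-closed set of frames containing `A₁` and avoiding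
`A₂(Λ₀)`.  Here is a concrete one: the frames `G` whose cubic frame has RATIONAL inner products with the cubic
frame of `A₁` (`⟪A₁ cᵢ, G cⱼ⟫ ∈ ℚ`).  It contains `A₁` (`rationalFrame_self`), is closed under `{111}` mirrors
(`rationalFrame_mirror`: a menu normal `m` of `G` has `G`-frame coordinates in `√(2/3)/√2 · ℤ`, and
`2 · (√(2/3)/√2)² = 2/3 ∈ ℚ`), and every slot of a lattice `G(Λ₀)` with `G` in it has `√2 ⟪A₁ cᵢ, ·⟫ ∈ ℚ`
(`rationalFrame_slot`).  Hence **`general_twoSlabAdhesion_irrational`**: the general-filling two-slab inequality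
(constant `2/2809`, clean slivers, `KissingGap δ` / `KissingClassification δ` by name) holds for every pair with ONE
irrational number `√2 ⟪A₁ cᵢ, A₂ w⟫` (`cᵢ` a cubic frame vector, `w` a slot) — all pairs outside a countable family.
WHAT THIS IS NOT: not the stub (chain pairs, the constant, the slivers); F-C1 not moved.
-/

noncomputable section

namespace Summit.Ventures.Crystal3D.Theorems

open Summit.Ventures.Crystal3D Finset
open Literature.MathematicalPhysics.StatisticalMechanics (fccStacking contactDeficiency)
open NearIdentity
open scoped InnerProductSpace

/-- Parseval in a moved cubic frame. -/
theorem inner_eq_sum_frame (L : EuclideanSpace ℝ (Fin 3) ≃ₗᵢ[ℝ] EuclideanSpace ℝ (Fin 3))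
    (x y : EuclideanSpace ℝ (Fin 3)) :
    ⟪x, y⟫_ℝ = ∑ l : Fin 3, ⟪x, L (cubicFrame l)⟫_ℝ * ⟪y, L (cubicFrame l)⟫_ℝ := by
  have h : ⟪x, y⟫_ℝ = ⟪L.symm x, L.symm y⟫_ℝ := by
    rw [← LinearIsometryEquiv.inner_map_map L (L.symm x), LinearIsometryEquiv.apply_symm_apply,
      LinearIsometryEquiv.apply_symm_apply]
  have hc : ∀ z : EuclideanSpace ℝ (Fin 3), ∀ l, ⟪z, L (cubicFrame l)⟫_ℝ = cubicCoords (L.symm z) l := by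
    intro z l
    rw [← inner_cubicFrame, ← LinearIsometryEquiv.inner_map_map L (L.symm z), LinearIsometryEquiv.apply_symm_apply]
  rw [h, inner_eq_cubicCoords]
  simp only [dotProduct, hc]

/-- A menu normal of `G` has `G`-frame coordinates in `(√(2/3)/√2)·ℤ`. -/
theorem frame_inner_menu (G : EuclideanSpace ℝ (Fin 3) ≃ₗᵢ[ℝ] EuclideanSpace ℝ (Fin 3))
    {m : EuclideanSpace ℝ (Fin 3)}
    (hmenu : ∀ w ∈ fccSlots, ⟪G w, m⟫_ℝ = 0 ∨ ⟪G w, m⟫_ℝ = Real.sqrt (2 / 3) ∨ ⟪G w, m⟫_ℝ = -Real.sqrt (2 / 3))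
    (j : Fin 3) : ∃ k : ℤ, ⟪G (cubicFrame j), m⟫_ℝ * Real.sqrt 2 = Real.sqrt (2 / 3) * k := by
  have hs0 : Real.sqrt 2 ≠ 0 := by positivity
  have val : ∀ w ∈ fccSlots, ∃ a : ℤ, ⟪G w, m⟫_ℝ = Real.sqrt (2 / 3) * a := by
    intro w hw
    rcases hmenu w hw with h | h | h
    · exact ⟨0, by rw [h]; simp⟩
    · exact ⟨1, by rw [h]; simp⟩
    · exact ⟨-1, by rw [h]; simp⟩
  obtain ⟨e0, e1, e2⟩ := cubicFrame_eq_slots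
  have key : ∀ (s t : EuclideanSpace ℝ (Fin 3)) (σ : ℝ), s ∈ fccSlots → t ∈ fccSlots → (σ = 1 ∨ σ = -1) →
      ∃ k : ℤ, ⟪G ((1 / Real.sqrt 2) • (s + σ • t)), m⟫_ℝ * Real.sqrt 2 = Real.sqrt (2 / 3) * k := by
    intro s t σ hs ht hσ
    obtain ⟨a, ha⟩ := val s hs
    obtain ⟨b, hb⟩ := val t ht
    have h1 : ∀ X : ℝ, 1 / Real.sqrt 2 * X * Real.sqrt 2 = X := fun X => by field_simp
    rw [map_smul, inner_smul_left, map_add, inner_add_left, map_smul, inner_smul_left, ha, hb]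
    simp only [conj_trivial]
    rw [h1]
    rcases hσ with rfl | rfl
    · exact ⟨a + b, by push_cast; ring⟩
    · exact ⟨a - b, by push_cast; ring⟩
  fin_cases j
  · obtain ⟨k, hk⟩ := key _ _ 1 (slotSite_mem 0) (slotSite_mem 1) (Or.inl rfl)
    refine ⟨k, ?_⟩
    rw [one_smul, ← e0] at hk
    exact hk
  · obtain ⟨k, hk⟩ := key _ _ (-1) (slotSite_mem 0) (slotSite_mem 1) (Or.inr rfl)
    refine ⟨k, ?_⟩
    rw [neg_one_smul, ← sub_eq_add_neg, ← e1] at hk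
    exact hk
  · obtain ⟨k, hk⟩ := key _ _ (-1) (slotSite_mem 4) (slotSite_mem 5) (Or.inr rfl)
    refine ⟨k, ?_⟩
    rw [neg_one_smul, ← sub_eq_add_neg, ← e2] at hk
    exact hk

/-- `A₁` is rational relative to itself. -/
theorem rationalFrame_self (A₁ : EuclideanSpace ℝ (Fin 3) ≃ₗᵢ[ℝ] EuclideanSpace ℝ (Fin 3)) :
    ∀ i j : Fin 3, ∃ q : ℚ, ⟪A₁ (cubicFrame i), A₁ (cubicFrame j)⟫_ℝ = (q : ℝ) := by
  intro i j
  refine ⟨if j = i then 1 else 0, ?_⟩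
  rw [LinearIsometryEquiv.inner_map_map, inner_cubicFrame, cubicCoords_cubicFrame, Pi.single_apply]
  split_ifs <;> simp

/-- Rationality is preserved by `{111}` mirrors. -/
theorem rationalFrame_mirror (A₁ G G' : EuclideanSpace ℝ (Fin 3) ≃ₗᵢ[ℝ] EuclideanSpace ℝ (Fin 3))
    {m : EuclideanSpace ℝ (Fin 3)}
    (hG : ∀ i j : Fin 3, ∃ q : ℚ, ⟪A₁ (cubicFrame i), G (cubicFrame j)⟫_ℝ = (q : ℝ))
    (hmenu : ∀ w ∈ fccSlots, ⟪G w, m⟫_ℝ = 0 ∨ ⟪G w, m⟫_ℝ = Real.sqrt (2 / 3) ∨ ⟪G w, m⟫_ℝ = -Real.sqrt (2 / 3))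
    (hG' : ∀ x, G' x = G x - (2 * ⟪G x, m⟫_ℝ) • m) :
    ∀ i j : Fin 3, ∃ q : ℚ, ⟪A₁ (cubicFrame i), G' (cubicFrame j)⟫_ℝ = (q : ℝ) := by
  intro i j
  have hs2 : Real.sqrt 2 * Real.sqrt 2 = 2 := Real.mul_self_sqrt (by norm_num)
  have hr2 : Real.sqrt (2 / 3) * Real.sqrt (2 / 3) = 2 / 3 := Real.mul_self_sqrt (by norm_num)
  choose q hq using hG
  choose k hk using frame_inner_menu G hmenu
  -- `2 ⟪G cⱼ, m⟫ ⟪G c_l, m⟫ = (2/3) kⱼ k_l`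
  have hYY : ∀ l, 2 * ⟪G (cubicFrame j), m⟫_ℝ * ⟪G (cubicFrame l), m⟫_ℝ = 2 / 3 * (k j) * (k l) := by
    intro l
    linear_combination (⟪G (cubicFrame l), m⟫_ℝ * Real.sqrt 2) * hk j + (Real.sqrt (2 / 3) * k j) * hk l +
      (-(⟪G (cubicFrame j), m⟫_ℝ * ⟪G (cubicFrame l), m⟫_ℝ)) * hs2 + ((k j : ℝ) * k l) * hr2
  -- `⟪A₁ cᵢ, m⟫` in the `G`-frame
  have hfm : ⟪A₁ (cubicFrame i), m⟫_ℝ = (q i 0 : ℝ) * ⟪G (cubicFrame 0), m⟫_ℝ +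
      (q i 1 : ℝ) * ⟪G (cubicFrame 1), m⟫_ℝ + (q i 2 : ℝ) * ⟪G (cubicFrame 2), m⟫_ℝ := by
    rw [inner_eq_sum_frame G]
    simp only [Fin.sum_univ_three, hq]
    rw [real_inner_comm (G (cubicFrame 0)) m, real_inner_comm (G (cubicFrame 1)) m,
      real_inner_comm (G (cubicFrame 2)) m]
  refine ⟨q i j - 2 / 3 * (k j) * ((q i 0) * k 0 + (q i 1) * k 1 + (q i 2) * k 2), ?_⟩
  rw [hG', inner_sub_right, inner_smul_right, hq, hfm]
  push_cast
  have h0 := hYY 0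
  have h1 := hYY 1
  have h2 := hYY 2
  linear_combination (-(q i 0 : ℝ)) * h0 + (-(q i 1 : ℝ)) * h1 + (-(q i 2 : ℝ)) * h2

/-- Slots of a rational lattice have rational `√2·⟪A₁ cᵢ, ·⟫`. -/
theorem rationalFrame_slot (A₁ G : EuclideanSpace ℝ (Fin 3) ≃ₗᵢ[ℝ] EuclideanSpace ℝ (Fin 3))
    (hG : ∀ i j : Fin 3, ∃ q : ℚ, ⟪A₁ (cubicFrame i), G (cubicFrame j)⟫_ℝ = (q : ℝ)) (i : Fin 3)
    {w : EuclideanSpace ℝ (Fin 3)} (hw : w ∈ fccSlots) :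
    ∃ q : ℚ, Real.sqrt 2 * ⟪A₁ (cubicFrame i), G w⟫_ℝ = (q : ℝ) := by
  choose q hq using hG
  obtain ⟨κ, rfl⟩ := exists_slotSite_eq hw
  have hc : ∀ l, ⟪G (slotSite κ), G (cubicFrame l)⟫_ℝ = (slotInt κ l : ℝ) / Real.sqrt 2 := by
    intro l
    rw [LinearIsometryEquiv.inner_map_map, inner_cubicFrame, cubicCoords_slotSite]; rfl
  have hs0 : Real.sqrt 2 ≠ 0 := by positivity
  refine ⟨q i 0 * slotInt κ 0 + q i 1 * slotInt κ 1 + q i 2 * slotInt κ 2, ?_⟩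
  rw [inner_eq_sum_frame G (A₁ (cubicFrame i))]
  simp only [Fin.sum_univ_three, hq, hc]
  push_cast
  field_simp

open scoped Classical in
/-- **The general-filling rung for irrational pairs.**  See the module docstring. -/
theorem general_twoSlabAdhesion_irrational {δ : ℝ} (hg : KissingGap δ) (hc : KissingClassification δ)
    (A₁ : EuclideanSpace ℝ (Fin 3) ≃ₗᵢ[ℝ] EuclideanSpace ℝ (Fin 3)) (t₁ : EuclideanSpace ℝ (Fin 3))
    (A₂ : EuclideanSpace ℝ (Fin 3) ≃ₗᵢ[ℝ] EuclideanSpace ℝ (Fin 3)) (t₂ : EuclideanSpace ℝ (Fin 3))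
    (hirr : ∃ i : Fin 3, ∃ w ∈ fccSlots, ∀ q : ℚ, Real.sqrt 2 * ⟪A₁ (cubicFrame i), A₂ w⟫_ℝ ≠ (q : ℝ)) :
    ∃ C R₀ : ℝ, 1 ≤ R₀ ∧ ∀ h : ℝ, 0 ≤ h → ∀ ρ : ℝ, R₀ ≤ ρ →
      ∀ X P₁ P₂ : Finset (EuclideanSpace ℝ (Fin 3)),
      (∀ p ∈ X, ∀ q ∈ X, p ≠ q → 1 ≤ dist p q) → P₁ ⊆ X → P₂ ⊆ X \ P₁ →
      (∀ p ∈ X, -(2 * R₀) ≤ p 2 ∧ p 2 ≤ h + 2 * R₀ ∧ p 0 ^ 2 + p 1 ^ 2 ≤ ρ ^ 2) →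
      (∀ p, p ∈ P₁ ↔ (p ∈ (fun q => A₁ q + t₁) '' fccStacking 1 (Real.sqrt (2 / 3)) ∧
        -(2 * R₀) ≤ p 2 ∧ p 2 ≤ -R₀ ∧ p 0 ^ 2 + p 1 ^ 2 ≤ ρ ^ 2)) →
      (∀ p, p ∈ P₂ ↔ (p ∈ (fun q => A₂ q + t₂) '' fccStacking 1 (Real.sqrt (2 / 3)) ∧
        h + R₀ ≤ p 2 ∧ p 2 ≤ h + 2 * R₀ ∧ p 0 ^ 2 + p 1 ^ 2 ≤ ρ ^ 2)) →
      (∀ p ∈ X, p 2 < -(2 * R₀) + 1 → p ∈ (fun q => A₁ q + t₁) '' fccStacking 1 (Real.sqrt (2 / 3))) →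
      (∀ p ∈ X, h + 2 * R₀ - 1 < p 2 → p ∈ (fun q => A₂ q + t₂) '' fccStacking 1 (Real.sqrt (2 / 3))) →
      ((((P₁ ×ˢ (X \ P₁)).filter fun pq => dist pq.1 pq.2 = 1).card : ℕ) : ℝ) +
        ((((P₂ ×ˢ ((X \ P₁) \ P₂)).filter fun pq => dist pq.1 pq.2 = 1).card : ℕ) : ℝ) ≤
        contactDeficiency ((X \ P₁) \ P₂) +
          (Real.sqrt 2 / 4 * ∑ᶠ w ∈ {w ∈ fccStacking 1 (Real.sqrt (2 / 3)) | ‖w‖ = 1},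
              |⟪w, A₁.symm (EuclideanSpace.single (2 : Fin 3) (1 : ℝ))⟫_ℝ| +
            Real.sqrt 2 / 4 * ∑ᶠ w ∈ {w ∈ fccStacking 1 (Real.sqrt (2 / 3)) | ‖w‖ = 1},
              |⟪w, A₂.symm (EuclideanSpace.single (2 : Fin 3) (1 : ℝ))⟫_ℝ|) * Real.pi * ρ ^ 2 -
          2 / 2809 * ρ ^ 2 + C * (1 + h) * ρ := by
  set 𝓕 : Set (EuclideanSpace ℝ (Fin 3) ≃ₗᵢ[ℝ] EuclideanSpace ℝ (Fin 3)) :=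
    {G | ∀ i j : Fin 3, ∃ q : ℚ, ⟪A₁ (cubicFrame i), G (cubicFrame j)⟫_ℝ = (q : ℝ)} with h𝓕
  refine general_twoSlabAdhesion_nonChain hg hc A₁ t₁ A₂ t₂ 𝓕 (rationalFrame_self A₁) ?_ ?_
  · -- avoidance
    intro G hG heq
    obtain ⟨i, w, hw, hirr⟩ := hirr
    have hA₂w : A₂ w ∈ G '' fccStacking 1 (Real.sqrt (2 / 3)) := by
      rw [heq]; exact ⟨w, mem_fcc_of_mem_fccSlots hw, rfl⟩
    obtain ⟨y, hy, hyw⟩ := hA₂w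
    have hy1 : ‖y‖ = 1 := by
      have := congrArg norm hyw
      rw [LinearIsometryEquiv.norm_map, LinearIsometryEquiv.norm_map, norm_eq_one_of_mem_fccSlots hw] at this
      exact this
    have hys : y ∈ fccSlots := mem_fccSlots_of_unit hy hy1
    obtain ⟨q, hq⟩ := rationalFrame_slot A₁ G hG i hys
    rw [hyw] at hq
    exact hirr q hq
  · -- closure
    intro G hG m _ hmenu G' hG'
    exact rationalFrame_mirror A₁ G G' hG hmenu hG'

end Summit.Ventures.Crystal3D.Theorems

end
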